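import Summits.ResolutionOfSingularities.ResolutionOfSingularities.Theorems.PurelyInseparableDim4SwapTransportWindowGluePrime
import HarnessLib
import HarnessLib.Audit.Tags

/-!
# Purely inseparable four-folds — WINDOW GLUE FOR EVERY σ = (n, n) + 0 (TWO FREE LETTERS): which chart a step of a twin-slot state of
# order `p + n` leaves, the twin ledger kept by a slot step, and `e_G` through the slot-unit relation (cell `res-dim4-pi`, K2(p) lane,
# B-LF (iii-b) class (iii), virtual port 1 ↦ n of the C∞ window, FILE G1 = W1a p712979 with `1 ↦ n`)

[OURS · counted 0 · cell `res-dim4-pi` · K2(p) lane (holder res-dim4-p-12 g5, ruling g5-21 (α): «class (iii) σ = (n,n)+0 = the VIRTUAL PORT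
1 ↦ n of typ-1's C∞ window half, modulo Q-FLAG»).]  Nothing here proves K2(p) for any `p`, any TAIL(p, d, 3), `NoIsolatedTrap p p` or
resolution of singularities in dimension ≥ 4 / characteristic `p` — NOT proved.  AI kernel work, weaker than expert review.  Bookkeeping
about ONE step of OUR frame; kills nothing by itself.

SETTING.  Letters `x, y` (slots, weight `n ≥ 1`) and two FREE letters `v, w`; a twin-slot state has `r = n·x + n·y` and order `p + n`
(`n + d = p`).  By `step_r_apply_gen` the chart letter of a `Step p` receives weight `ord − p = n`, a translated letter `0`, the others keep.
* §1 **`step_cases_of_weights_sigma0`** — if the child's weights again have degree `2n`, the step is a SLOT step (`jr ∈ {x, y}`, the other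
  slot untranslated, weights kept) or a ROTATION through a free letter (`jr ∈ {v, w}`, exactly one slot translated away, child weights
  `n·jr + n·(kept slot)`); `step_r_pair_of_slot_sigma0` — a slot step with the other slot untranslated keeps `n·x + n·y`.
* §2 **`eG_transfer_sigma0`** — through a slot-unit-class relation (`θ(x_{πλ}) = x_λ e_λ`, `θ(x_{πμ}) = x_μ e_μ`, free block invertible)
  between twin-slot states at an order prime to `p` the polar-kernel ranks agree (`SwapNorm.finrank_resVertex_eq_of_slotUnit_rel`, any weights).
[cite: Hauser2010, §F] [cite: HauserPerlega2019PRIMS, §2 (transform D′ of D)] [cite: CossartJannsenSaito2020, Def. 2.18, Thm. 3.14]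
bears_on: LADDER-RESOLUTION:D157-DOOR2 (res-dim4-pi · K2(p) B-LF (iii-b) class (iii) virtual port G1).  Supports
stmt-ResolutionOfSingularities-16155 (helper).
-/

set_option linter.dupNamespace false -- mandated namespace of this single-conjunct summit

noncomputable section

namespace Summit.ResolutionOfSingularities.ResolutionOfSingularities.Theorems.PIDim4

namespace SwapTransport

open MvPolynomial Finset
open Literature.AlgebraicGeometry.Resolution
open Literature.AlgebraicGeometry.Resolution.CentreBlowup
open Literature.AlgebraicGeometry.Resolution.Hauser2010
open Literature.AlgebraicGeometry.Resolution.HauserPerlega2019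

variable {K : Type} [Field K] [DecidableEq K]

/-! ## §1 Which chart a step of a twin-slot state leaves -/

/-- **WHICH SLOT A STEP LEAVES, every σ = (n, n) + 0.**  `A` has weights `n·x + n·y` (`x, y, v, w` the four distinct letters), order
`p + n`, `0 < n`; a `Step p` in chart `jr` with translation `b` whose child has weights of degree `2n` is: (slot `x`) `jr = x`, `b y = 0`,
child weights `n·x + n·y`; or (slot `y`) symmetrically; or (rotation through `jr ∈ {v, w}`) exactly one of `x, y` is kept and the child
weights are `n·jr + n·(kept)`. [OURS] [cite: Hauser2010, §F] -/
theorem step_cases_of_weights_sigma0 (p : ℕ) {n : ℕ} (hn : 0 < n) {x y v w : Fin 4} (hxy : x ≠ y) (hxv : x ≠ v) (hxw : x ≠ w)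
    (hyv : y ≠ v) (hyw : y ≠ w) (hvw : v ≠ w) {A : State K} (hrA : A.r = Finsupp.single x n + Finsupp.single y n)
    (ho : ordZero A.F = ((p + n : ℕ) : ℕ∞)) {jr : Fin 4} {b : Fin 4 → K}
    (hdeg : (CentreBlowup.step p Finset.univ jr b A).r.degree = 2 * n) :
    (jr = x ∧ b y = 0 ∧ (CentreBlowup.step p Finset.univ jr b A).r = Finsupp.single x n + Finsupp.single y n) ∨
    (jr = y ∧ b x = 0 ∧ (CentreBlowup.step p Finset.univ jr b A).r = Finsupp.single x n + Finsupp.single y n) ∨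
    ((jr = v ∨ jr = w) ∧
      ((b x ≠ 0 ∧ b y = 0 ∧ (CentreBlowup.step p Finset.univ jr b A).r = Finsupp.single jr n + Finsupp.single y n) ∨
       (b y ≠ 0 ∧ b x = 0 ∧ (CentreBlowup.step p Finset.univ jr b A).r = Finsupp.single jr n + Finsupp.single x n))) := by
  set r' := (CentreBlowup.step p Finset.univ jr b A).r with hr'
  have hval : ∀ i, r' i = if i = jr then n else if b i = 0 then A.r i else 0 := fun i => by
    rw [hr', step_r_apply_gen p ho jr b i, Nat.add_sub_cancel_left]
  obtain ⟨hAx, hAy, hAv, hAw⟩ := ResCone.quad_apply hxy hxv hxw hyv hyw hvw n n 0 0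
  have hrA' : A.r = Finsupp.single x n + Finsupp.single y n + Finsupp.single v 0 + Finsupp.single w 0 := by
    rw [hrA, Finsupp.single_zero, Finsupp.single_zero, add_zero, add_zero]
  rw [← hrA'] at hAx hAy hAv hAw
  have hsum : r'.degree = r' x + r' y + r' v + r' w := ResCone.degree_eq_quad hxy hxv hxw hyv hyw hvw r'
  rw [hdeg] at hsum
  have hr'eq : r' = Finsupp.single x (r' x) + Finsupp.single y (r' y) + Finsupp.single v (r' v) + Finsupp.single w (r' w) :=
    ResCone.eq_sum_single_four hxy hxv hxw hyv hyw hvw r'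
  have hrx := hval x
  have hry := hval y
  have hrv := hval v
  have hrw := hval w
  rw [hAx] at hrx
  rw [hAy] at hry
  rw [hAv, ite_self] at hrv
  rw [hAw, ite_self] at hrw
  rcases ResCone.letters_exhaust hxy hxv hxw hyv hyw hvw jr with h | h | h | h
  · -- slot `x`
    subst h
    refine Or.inl ⟨rfl, ?_, ?_⟩
    · by_contra hby
      rw [if_pos rfl] at hrx
      rw [if_neg (Ne.symm hxy), if_neg hby] at hry
      rw [if_neg (Ne.symm hxv)] at hrv
      rw [if_neg (Ne.symm hxw)] at hrw
      omega
    · have hby : b y = 0 := by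
        by_contra hby
        rw [if_pos rfl] at hrx
        rw [if_neg (Ne.symm hxy), if_neg hby] at hry
        rw [if_neg (Ne.symm hxv)] at hrv
        rw [if_neg (Ne.symm hxw)] at hrw
        omega
      rw [if_pos rfl] at hrx
      rw [if_neg (Ne.symm hxy), if_pos hby] at hry
      rw [if_neg (Ne.symm hxv)] at hrv
      rw [if_neg (Ne.symm hxw)] at hrw
      rw [hr'eq, hrx, hry, hrv, hrw, Finsupp.single_zero, Finsupp.single_zero, add_zero, add_zero]
  · -- slot `y`
    subst h
    refine Or.inr (Or.inl ⟨rfl, ?_, ?_⟩)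
    · by_contra hbx
      rw [if_neg hxy, if_neg hbx] at hrx
      rw [if_pos rfl] at hry
      rw [if_neg (Ne.symm hyv)] at hrv
      rw [if_neg (Ne.symm hyw)] at hrw
      omega
    · have hbx : b x = 0 := by
        by_contra hbx
        rw [if_neg hxy, if_neg hbx] at hrx
        rw [if_pos rfl] at hry
        rw [if_neg (Ne.symm hyv)] at hrv
        rw [if_neg (Ne.symm hyw)] at hrw
        omega
      rw [if_neg hxy, if_pos hbx] at hrx
      rw [if_pos rfl] at hry
      rw [if_neg (Ne.symm hyv)] at hrv
      rw [if_neg (Ne.symm hyw)] at hrw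
      rw [hr'eq, hrx, hry, hrv, hrw, Finsupp.single_zero, Finsupp.single_zero, add_zero, add_zero]
  · -- rotation through `v`
    subst h
    refine Or.inr (Or.inr ⟨Or.inl rfl, ?_⟩)
    rw [if_neg hxv] at hrx
    rw [if_neg hyv] at hry
    rw [if_pos rfl] at hrv
    rw [if_neg (Ne.symm hvw)] at hrw
    by_cases hbx : b x = 0
    · rw [if_pos hbx] at hrx
      have hby : b y ≠ 0 := by
        intro hby; rw [if_pos hby] at hry; omega
      rw [if_neg hby] at hry
      refine Or.inr ⟨hby, hbx, ?_⟩
      rw [hr'eq, hrx, hry, hrv, hrw, Finsupp.single_zero, Finsupp.single_zero, add_zero, add_zero, add_comm]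
    · rw [if_neg hbx] at hrx
      have hby : b y = 0 := by
        by_contra hby; rw [if_neg hby] at hry; omega
      rw [if_pos hby] at hry
      refine Or.inl ⟨hbx, hby, ?_⟩
      rw [hr'eq, hrx, hry, hrv, hrw, Finsupp.single_zero, Finsupp.single_zero, zero_add, add_zero, add_comm]
  · -- rotation through `w`
    subst h
    refine Or.inr (Or.inr ⟨Or.inr rfl, ?_⟩)
    rw [if_neg hxw] at hrx
    rw [if_neg hyw] at hry
    rw [if_neg hvw] at hrv
    rw [if_pos rfl] at hrw
    by_cases hbx : b x = 0
    · rw [if_pos hbx] at hrx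
      have hby : b y ≠ 0 := by
        intro hby; rw [if_pos hby] at hry; omega
      rw [if_neg hby] at hry
      refine Or.inr ⟨hby, hbx, ?_⟩
      rw [hr'eq, hrx, hry, hrv, hrw, Finsupp.single_zero, Finsupp.single_zero, add_zero, add_zero, add_comm]
    · rw [if_neg hbx] at hrx
      have hby : b y = 0 := by
        by_contra hby; rw [if_neg hby] at hry; omega
      rw [if_pos hby] at hry
      refine Or.inl ⟨hbx, hby, ?_⟩
      rw [hr'eq, hrx, hry, hrv, hrw, Finsupp.single_zero, Finsupp.single_zero, zero_add, add_zero, add_comm]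

/-- The twin ledger `n·x + n·y` survives a slot step in the chart of `x` with a translation vanishing on `y` (order `p + n`; the free
letters may be translated). [OURS · bookkeeping] [cite: HauserPerlega2019PRIMS, §2 (transform D′ of D)] -/
theorem step_r_pair_of_slot_sigma0 (p : ℕ) {n : ℕ} {x y v w : Fin 4} (hxy : x ≠ y) (hxv : x ≠ v) (hxw : x ≠ w) (hyv : y ≠ v)
    (hyw : y ≠ w) (hvw : v ≠ w) {B : State K} (hrB : B.r = Finsupp.single x n + Finsupp.single y n)
    (hoB : ordZero B.F = ((p + n : ℕ) : ℕ∞)) {b' : Fin 4 → K} (hb'y : b' y = 0) :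
    (CentreBlowup.step p Finset.univ x b' B).r = Finsupp.single x n + Finsupp.single y n := by
  obtain ⟨-, h2, h3, h4⟩ := ResCone.quad_apply hxy hxv hxw hyv hyw hvw n n 0 0
  have hrB4 : B.r = Finsupp.single x n + Finsupp.single y n + Finsupp.single v 0 + Finsupp.single w 0 := by
    rw [hrB, Finsupp.single_zero, Finsupp.single_zero, add_zero, add_zero]
  have hval : ∀ i, (CentreBlowup.step p Finset.univ x b' B).r i = if i = x then n else if b' i = 0 then B.r i else 0 := fun i => by
    rw [step_r_apply_gen p hoB x b' i, Nat.add_sub_cancel_left]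
  rw [ResCone.eq_sum_single_four hxy hxv hxw hyv hyw hvw (CentreBlowup.step p Finset.univ x b' B).r, hval, hval, hval, hval,
    if_pos rfl, if_neg hxy.symm, if_pos hb'y, if_neg (Ne.symm hxv), if_neg (Ne.symm hxw), hrB4, h2, h3, h4, ite_self, ite_self,
    Finsupp.single_zero, Finsupp.single_zero, add_zero, add_zero]

/-! ## §2 `e_G` through the relation, every σ = (n, n) + 0 -/

omit [DecidableEq K] in
/-- **`e_G` TRANSFER, twin slots of weight `n`** — through a two-slot slot-unit-class relation at an order `o` prime to `p` the
polar-kernel ranks of twin-slot states (`A.r = n·x_{πλ} + n·x_{πμ}`, `B.r = n·x_λ + n·x_μ`) agree; the 4×4 tangent is invertible by the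
free 2×2 block (`isUnit_det_slotUnitClass₂`). [OURS] [cite: CossartJannsenSaito2020, Def. 2.18] -/
theorem eG_transfer_sigma0 (p : ℕ) [Fact p.Prime] [CharP K p] {n : ℕ} {π : Equiv.Perm (Fin 4)} {la mu u f : Fin 4} (hlm : la ≠ mu)
    (hlu : la ≠ u) (hlf : la ≠ f) (hmu : mu ≠ u) (hmf : mu ≠ f) (huf : u ≠ f) {A B : State K}
    {θ e : Fin 4 → MvPolynomial (Fin 4) K} {U E : MvPolynomial (Fin 4) K} {M o : ℕ}
    (hθa : θ (π la) = X la * e la) (hθa' : θ (π mu) = X mu * e mu) (hea : constantCoeff (e la) ≠ 0)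
    (hea' : constantCoeff (e mu) ≠ 0) (hu0 : constantCoeff (θ (π u)) = 0) (hf0 : constantCoeff (θ (π f)) = 0)
    (hdet : coeff (Finsupp.single u 1) (θ (π u)) * coeff (Finsupp.single f 1) (θ (π f)) -
      coeff (Finsupp.single f 1) (θ (π u)) * coeff (Finsupp.single u 1) (θ (π f)) ≠ 0)
    (hU : constantCoeff U ≠ 0) (hE : E ∈ originIdeal K ^ M) (hrel : B.F = deletePthPowers p (U ^ p * aeval θ A.F) + E)
    (hrA : A.r = Finsupp.single (π la) n + Finsupp.single (π mu) n) (hrB : B.r = Finsupp.single la n + Finsupp.single mu n)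
    (hdivA : ∀ d ∈ A.F.support, A.r ≤ d) (hoA : ordZero A.F = ((o : ℕ) : ℕ∞)) (hpo : ¬ p ∣ o) (hoM : o < M) :
    Module.finrank K (ResCone.resVertex B) = Module.finrank K (ResCone.resVertex A) := by
  have hslot := fun (i : Fin 4) (hiu : i ≠ u) (hif : i ≠ f) => SwapNorm.eq_slot_of_ne hlm hlu hlf hmu hmf huf hiu hif
  have hθi : ∀ i, i ≠ u → i ≠ f → θ (π i) = X i * e i := fun i hiu hif => by
    rcases hslot i hiu hif with rfl | rfl
    · exact hθa
    · exact hθa'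
  have he : ∀ i, i ≠ u → i ≠ f → constantCoeff (e i) ≠ 0 := fun i hiu hif => by
    rcases hslot i hiu hif with rfl | rfl
    · exact hea
    · exact hea'
  have hθ0 : ∀ k, constantCoeff (θ k) = 0 := fun k => by
    obtain ⟨i, rfl⟩ := π.surjective k
    by_cases hiu : i = u
    · subst hiu; exact hu0
    by_cases hif : i = f
    · subst hif; exact hf0
    rw [hθi i hiu hif, map_mul, constantCoeff_X, zero_mul]
  have hπu : π u ≠ π la ∧ π u ≠ π mu := ⟨fun h => hlu (π.injective h).symm, fun h => hmu (π.injective h).symm⟩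
  have hπf : π f ≠ π la ∧ π f ≠ π mu := ⟨fun h => hlf (π.injective h).symm, fun h => hmf (π.injective h).symm⟩
  have hru : A.r (π u) = 0 := by
    rw [hrA, Finsupp.add_apply, Finsupp.single_eq_of_ne hπu.1, Finsupp.single_eq_of_ne hπu.2, add_zero]
  have hrf : A.r (π f) = 0 := by
    rw [hrA, Finsupp.add_apply, Finsupp.single_eq_of_ne hπf.1, Finsupp.single_eq_of_ne hπf.2, add_zero]
  have hrB' : B.r = A.r.mapDomain π.symm := by
    rw [hrA, hrB, Finsupp.mapDomain_add, Finsupp.mapDomain_single, Finsupp.mapDomain_single, Equiv.symm_apply_apply,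
      Equiv.symm_apply_apply]
  exact SwapNorm.finrank_resVertex_eq_of_slotUnit_rel p hθi he hθ0
    (isUnit_det_slotUnitClass₂ hlm hlu hlf hmu hmf huf hθa hθa' hea hea' hdet) hU hE hrel hoA hpo hoM hdivA hru hrf hrB'

end SwapTransport

end Summit.ResolutionOfSingularities.ResolutionOfSingularities.Theorems.PIDim4

end
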